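import Summits.HubbardSuperconductivity.HubbardSuperconductivity.Theorems.CooperPairDMottWalkDiluteBECBridgeNormalForm
import Summits.HubbardSuperconductivity.HubbardSuperconductivity.Theorems.CooperPairDMottWalkDiluteBECBridgeDichotomy
import Summits.HubbardSuperconductivity.HubbardSuperconductivity.Theorems.CooperPairDMottWalkGlue
import HarnessLib.Audit.CruxProbe

/-! BC2/BC7-style mechanical probe of the crux `DiluteBECBridge` (stmt-HubbardSuperconductivity-10314)
against the summit (strategist r1): P5 `C → S` (summit strength) / `S → C` (informational), plus the
tautology / vacuity / rigidity batteries, with the landed dichotomy / normal-form theorems in scope. -/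

set_option h21.cruxProbe.batteryMs 90000 in
#h21_crux_probe Summit.HubbardSuperconductivity.HubbardSuperconductivity.Theses.CooperPairDMottWalk.DiluteBECBridge route := "route-HubbardSuperconductivity-CooperPairDMottWalk"
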